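import Summits.Ventures.Crystal3D.Theorems.StickyWulffConstantNoReconstructionGainJointBoundLevelDefs
import HarnessLib

/-!
# Joint level/support bound — the finite case check for the `1/20`-level row

HONEST FRAMING. Part of the venture `Summits/Ventures/Crystal3D` (cell `crystal3d-full`), helper
`--supports` the crux `NoReconstructionGain` (stmt-Ventures-19144, route
`route-Ventures-StickyWulffConstant`), line `joint-level-support-bound`, stub
`stub_jointBound_levelHeavy20` (skeleton v2).  The tuple check `jbTupleOK` of
`…JointBoundLevelDefs` holds for every band tuple whose base band is the shallowest: 1 296 tuples,
each with 56 level distributions, verified by the kernel (`decide +kernel`, plain `Decidable`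
evaluation — no `native_decide`, standard axioms).

WHAT THIS IS NOT: geometry; rung F-C1 not moved.
-/

namespace Summit.Ventures.Crystal3D.Theorems

set_option synthInstance.maxSize 2000 in
set_option synthInstance.maxHeartbeats 200000 in
/-- **All band tuples pass the check** (base band `bs` shallowest). -/
theorem jb_tuples_ok : ∀ bs, bs < 8 → ∀ b1, b1 < 8 → ∀ b2, b2 < 8 → ∀ b3, b3 < 8 →
    (!(decide (bs ≤ b1) && decide (bs ≤ b2) && decide (bs ≤ b3)) || jbTupleOK bs b1 b2 b3) = true := by
  decide +kernel

/-- The tuple check for given bands with the base band shallowest. -/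
theorem jb_tuple_ok (bs b1 b2 b3 : ℕ) (hbs : bs < 8) (h1 : b1 < 8) (h2 : b2 < 8) (h3 : b3 < 8)
    (h01 : bs ≤ b1) (h02 : bs ≤ b2) (h03 : bs ≤ b3) : jbTupleOK bs b1 b2 b3 = true := by
  have h := jb_tuples_ok bs hbs b1 h1 b2 h2 b3 h3
  simp only [h01, h02, h03, decide_true, Bool.and_self, Bool.not_true, Bool.false_or] at h
  exact h

end Summit.Ventures.Crystal3D.Theorems
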